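import Literature.RingTheory.MvPolynomial.BooleanLexNormalForm
import Mathlib.Algebra.MvPolynomial.Monad
import Mathlib.Combinatorics.SimpleGraph.Basic
import HarnessLib

/-!
# `0/1` codes of partial `3`-colourings and their monomials
# (the polynomial encoding of `CSP(K₃)`, Conneryd–Ghannane–Pang 2025 §2.5, over `ℤ`)

Topic `Literature/ModelTheory/FiniteModelTheory`.  Vocabulary for the ideal-reduction proof of
the named fact `connerydGhannanePang2025_thm_6_1` (assembled in
`CohomologicalConsistencyIdealReduction.lean`), following arXiv:2511.17272 §2.5 and Appendix A:

* `zeroOneVecs`, `IsColouringCode`, `pts G enc W` — the point set `𝒱_W ⊆ {0,1}^N` of `0/1`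
  vectors whose `W`-part is the indicator vector of a proper `3`-colouring of `G[W]` (exactly one
  colour per vertex of `W`, no monochromatic edge inside `W`), the other coordinates free
  (variables `x_{v,i}` numbered by a bijection `enc : V × Fin 3 ≃ Fin N`).  Its vanishing ideal
  (`Literature.RingTheory.MvPolynomial.vanishing`) stands in for the ideal `⟨W⟩ = ⟨P_{G[W] → K₃}⟩`
  of §4 (they have the same normal forms on `W`-supported polynomials).  Basic facts:
  antitonicity `pts_antitone`, one colour per vertex (`code_eq_zero_of_ne`, `sum_code_eq_one`),
  codes of maps (`codeOf`, `codeOf_mem_pts`: satisfiability gives points) and the CYLINDER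
  PROPERTY `restrictCode_mem_pts` (zeroing the coordinates outside `W` keeps a code a code).
* `mono enc U θ = ∏_{u ∈ U} x_{u, θ u}` — the monomial `m_θ` of a partial map `θ : U → [3]`
  (§2.5), with `eval_mono`, `mono_empty`, `fst_mem_of_mem_support_mono`.
* `killOutside enc W` — the substitution `x_j ↦ 0` for the variables of the vertices outside `W`,
  and **Claim A.2** `support_normalForm_subset`: the (integral, lexicographic) normal form modulo
  `I(𝒱_W)` of a `W`-supported polynomial is `W`-supported (kill the outside variables: by the
  cylinder property the result is still a reduced representative, hence THE normal form).

## References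

* [ConnerydGhannanePang2025] arXiv:2511.17272, §2.5, §4, App. A (Claim A.2). READ.
-/

noncomputable section

open MvPolynomial Finset
open Literature.RingTheory.MvPolynomial

namespace Literature.ModelTheory.FiniteModelTheory

namespace ConnerydGhannanePang

variable {V : Type*} {G : SimpleGraph V} {N : ℕ} {enc : V × Fin 3 ≃ Fin N}

section Codes

/-! ### `0/1` codes of partial proper `3`-colourings -/

/-- The `0/1` vectors of length `N`, as a finset of integer vectors. [folklore] -/
def zeroOneVecs (N : ℕ) : Finset (Fin N → ℤ) :=
  (Finset.univ : Finset (Fin N → Bool)).image fun z j => if z j then 1 else 0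

/-- Membership in `zeroOneVecs`. [folklore] -/
theorem mem_zeroOneVecs {y : Fin N → ℤ} : y ∈ zeroOneVecs N ↔ ∀ j, y j = 0 ∨ y j = 1 := by
  constructor
  · rintro hy j
    obtain ⟨z, -, rfl⟩ := Finset.mem_image.1 hy
    by_cases hz : z j <;> simp [hz]
  · intro hy
    refine Finset.mem_image.2 ⟨fun j => decide (y j = 1), Finset.mem_univ _, funext fun j => ?_⟩
    rcases hy j with h | h <;> simp [h]

variable (G enc) in
/-- `y` CODES A PROPER `3`-COLOURING ON `W`: exactly one colour per vertex of `W` and no edge of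
`G[W]` monochromatic (the common zeros of the axioms `P_{G[W] → K₃}` of §2.5 among `0/1`
vectors). [cite: ConnerydGhannanePang2025, §2.5] -/
def IsColouringCode (W : Finset V) (y : Fin N → ℤ) : Prop :=
  (∀ w ∈ W, ∃! i : Fin 3, y (enc (w, i)) = 1) ∧
    ∀ w ∈ W, ∀ w' ∈ W, G.Adj w w' → ∀ i : Fin 3, y (enc (w, i)) = 1 → y (enc (w', i)) = 1 → False

variable (G enc) in
open Classical in
/-- `𝒱_W`: the `0/1` vectors coding a proper `3`-colouring on `W` (free outside `W`); its
vanishing ideal replaces `⟨W⟩`. [cite: ConnerydGhannanePang2025, §4 (the ideals `⟨X⟩`)] -/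
def pts (W : Finset V) : Finset (Fin N → ℤ) :=
  (zeroOneVecs N).filter (IsColouringCode G enc W)

/-- Membership in `𝒱_W`. [folklore] -/
theorem mem_pts {W : Finset V} {y : Fin N → ℤ} :
    y ∈ pts G enc W ↔ (∀ j, y j = 0 ∨ y j = 1) ∧ IsColouringCode G enc W y := by
  classical
  rw [pts, Finset.mem_filter, mem_zeroOneVecs]

/-- `𝒱_W` is a `0/1` point set. [folklore] -/
theorem isZeroOne_pts (W : Finset V) : IsZeroOne (pts G enc W) :=
  fun _ hy => (mem_pts.1 hy).1

/-- `W ⊆ W'` gives `𝒱_{W'} ⊆ 𝒱_W` (hence `I(𝒱_W) ⊆ I(𝒱_{W'})`, i.e. `⟨W⟩ ⊆ ⟨W'⟩`). [folklore] -/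
theorem pts_antitone {W W' : Finset V} (h : W ⊆ W') : pts G enc W' ⊆ pts G enc W := by
  intro y hy
  rw [mem_pts] at hy ⊢
  exact ⟨hy.1, fun w hw => hy.2.1 w (h hw), fun w hw w' hw' => hy.2.2 w (h hw) w' (h hw')⟩

/-- In a code, a vertex of `W` has colour `i` with value `1` and all other colours `0`.
[folklore] -/
theorem code_eq_zero_of_ne {W : Finset V} {y : Fin N → ℤ} (hy : y ∈ pts G enc W) {w : V}
    (hw : w ∈ W) {i j : Fin 3} (hi : y (enc (w, i)) = 1) (hij : j ≠ i) : y (enc (w, j)) = 0 := by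
  obtain ⟨h01, hcode, -⟩ := mem_pts.1 hy
  obtain ⟨i₀, -, huniq⟩ := hcode w hw
  rcases h01 (enc (w, j)) with h0 | h1
  · exact h0
  · exact absurd ((huniq j h1).trans (huniq i hi).symm) hij

/-- In a code the colour indicators of a vertex of `W` sum to `1`. [folklore] -/
theorem sum_code_eq_one {W : Finset V} {y : Fin N → ℤ} (hy : y ∈ pts G enc W) {w : V}
    (hw : w ∈ W) : ∑ i : Fin 3, y (enc (w, i)) = 1 := by
  obtain ⟨i, hi, -⟩ := (mem_pts.1 hy).2.1 w hw
  rw [← Finset.sum_erase_add _ _ (Finset.mem_univ i), hi]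
  rw [Finset.sum_eq_zero fun j hj => code_eq_zero_of_ne hy hw hi (Finset.ne_of_mem_erase hj)]
  rw [zero_add]

variable (enc) in
/-- THE CODE OF A MAP `c : V → [3]`: `y_{v,i} = [c v = i]`. [cite: ConnerydGhannanePang2025, §2.5] -/
def codeOf (c : V → Fin 3) : Fin N → ℤ :=
  fun j => if c (enc.symm j).1 = (enc.symm j).2 then 1 else 0

/-- Values of `codeOf`. [folklore] -/
theorem codeOf_apply (c : V → Fin 3) (v : V) (i : Fin 3) :
    codeOf enc c (enc (v, i)) = if c v = i then 1 else 0 := by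
  simp [codeOf]

/-- The code of a map that is a proper colouring on `W` lies in `𝒱_W` (SATISFIABILITY gives
points). [folklore] -/
theorem codeOf_mem_pts {W : Finset V} {c : V → Fin 3}
    (hc : ∀ u ∈ W, ∀ v ∈ W, G.Adj u v → c u ≠ c v) : codeOf enc c ∈ pts G enc W := by
  refine mem_pts.2 ⟨fun j => ?_, fun w _ => ⟨c w, ?_, fun i hi => ?_⟩, fun w hw w' hw' hadj i hi hi' => ?_⟩
  · unfold codeOf; split_ifs <;> simp
  · show codeOf enc c (enc (w, c w)) = 1
    rw [codeOf_apply, if_pos rfl]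
  · have hi : codeOf enc c (enc (w, i)) = 1 := hi
    rw [codeOf_apply] at hi
    by_contra hne
    rw [if_neg (Ne.symm hne)] at hi
    exact zero_ne_one hi
  · rw [codeOf_apply] at hi hi'
    have h1 : c w = i := by by_contra h; rw [if_neg h] at hi; exact zero_ne_one hi
    have h2 : c w' = i := by by_contra h; rw [if_neg h] at hi'; exact zero_ne_one hi'
    exact hc w hw w' hw' hadj (h1.trans h2.symm)

variable [DecidableEq V]

/-- CYLINDER PROPERTY: membership in `𝒱_W` only depends on the `W`-coordinates — zeroing the
coordinates of the vertices outside `W` keeps a code a code. [folklore] -/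
theorem restrictCode_mem_pts {W : Finset V} {y : Fin N → ℤ} (hy : y ∈ pts G enc W) :
    (fun j => if (enc.symm j).1 ∈ W then y j else 0) ∈ pts G enc W := by
  obtain ⟨h01, hcode, hedge⟩ := mem_pts.1 hy
  have hin : ∀ w ∈ W, ∀ i : Fin 3,
      (fun j => if (enc.symm j).1 ∈ W then y j else 0) (enc (w, i)) = y (enc (w, i)) := by
    intro w hw i
    simp [hw]
  refine mem_pts.2 ⟨fun j => ?_, fun w hw => ?_, fun w hw w' hw' hadj i hi hi' => ?_⟩
  · by_cases hj : (enc.symm j).1 ∈ W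
    · simp only [hj, if_true]; exact h01 j
    · simp [hj]
  · simp_rw [hin w hw]; exact hcode w hw
  · rw [hin w hw] at hi; rw [hin w' hw'] at hi'
    exact hedge w hw w' hw' hadj i hi hi'

/-! ### Monomials of partial maps -/

/-- Extend a section `θ : U → [3]` to all of `V` (by the colour `0` off `U`). [folklore] -/
def totalize {U : Finset V} (θ : ↥U → Fin 3) : V → Fin 3 :=
  fun u => if hu : u ∈ U then θ ⟨u, hu⟩ else 0

/-- `totalize` on `U`. [folklore] -/
theorem totalize_of_mem {U : Finset V} (θ : ↥U → Fin 3) {u : V} (hu : u ∈ U) :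
    totalize θ u = θ ⟨u, hu⟩ :=
  dif_pos hu

variable (enc) in
/-- THE MONOMIAL `m_θ = ∏_{u ∈ U} x_{u, θ u}` of a partial map `θ : U → [3]`.
[cite: ConnerydGhannanePang2025, §2.5] -/
def mono (U : Finset V) (θ : ↥U → Fin 3) : MvPolynomial (Fin N) ℤ :=
  ∏ u ∈ U, X (enc (u, totalize θ u))

/-- Evaluation of `m_θ` at a point. [folklore] -/
theorem eval_mono (y : Fin N → ℤ) (U : Finset V) (θ : ↥U → Fin 3) :
    eval y (mono enc U θ) = ∏ u ∈ U, y (enc (u, totalize θ u)) := by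
  unfold mono
  rw [eval_prod]
  simp only [eval_X]

/-- The empty monomial is `1`. [folklore] -/
theorem mono_empty (θ : ↥(∅ : Finset V) → Fin 3) : mono enc ∅ θ = 1 := by
  unfold mono
  exact Finset.prod_empty

/-! ### Supports stay inside the closure (Claim A.2) -/

/-- The variables of `m_θ` belong to the vertices of `U`. [folklore] -/
theorem fst_mem_of_mem_support_mono {U : Finset V} (θ : ↥U → Fin 3) {α : Fin N →₀ ℕ}
    (hα : α ∈ (mono enc U θ).support) {j : Fin N} (hj : j ∈ α.support) : (enc.symm j).1 ∈ U := by
  classical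
  unfold mono at hα
  rw [show (∏ u ∈ U, X (enc (u, totalize θ u)) : MvPolynomial (Fin N) ℤ) =
      monomial (∑ u ∈ U, Finsupp.single (enc (u, totalize θ u)) 1) 1 by
    rw [monomial_sum_one]; rfl] at hα
  rw [support_monomial, if_neg one_ne_zero, Finset.mem_singleton] at hα
  subst hα
  obtain ⟨u, hu, hju⟩ := Finset.mem_biUnion.1 (Finsupp.support_finsetSum hj)
  obtain ⟨rfl, -⟩ := Finsupp.mem_support_single _ _ _ |>.1 hju
  simpa using hu

variable (enc) in
/-- KILLING THE VARIABLES OUTSIDE `W`: `x_j ↦ x_j` if the vertex of `j` lies in `W`, `x_j ↦ 0`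
otherwise (the restriction `ρ` of Claim A.2). [cite: ConnerydGhannanePang2025, App. A, Claim A.2] -/
def killOutside (W : Finset V) : MvPolynomial (Fin N) ℤ →ₐ[ℤ] MvPolynomial (Fin N) ℤ :=
  bind₁ fun j => if (enc.symm j).1 ∈ W then X j else 0

/-- `killOutside` on a monomial: identity if all its variables lie over `W`, zero otherwise.
[folklore] -/
theorem killOutside_monomial (W : Finset V) (α : Fin N →₀ ℕ) (c : ℤ) :
    killOutside enc W (monomial α c) =
      if ∀ j ∈ α.support, (enc.symm j).1 ∈ W then monomial α c else 0 := by
  unfold killOutside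
  rw [bind₁_monomial]
  split_ifs with h
  · rw [monomial_eq, Finsupp.prod]
    congr 1
    exact Finset.prod_congr rfl fun j hj => by rw [if_pos (h j hj)]
  · push Not at h
    obtain ⟨j, hj, hjW⟩ := h
    rw [Finset.prod_eq_zero hj (by rw [if_neg hjW, zero_pow (Finsupp.mem_support_iff.1 hj)]),
      mul_zero]

/-- `killOutside` in the monomial basis. [folklore] -/
theorem killOutside_eq_sum (W : Finset V) (f : MvPolynomial (Fin N) ℤ) :
    killOutside enc W f = ∑ α ∈ f.support.filter (fun α => ∀ j ∈ α.support, (enc.symm j).1 ∈ W),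
      monomial α (coeff α f) := by
  classical
  conv_lhs => rw [f.as_sum]
  rw [map_sum, Finset.sum_filter]
  exact Finset.sum_congr rfl fun α _ => killOutside_monomial W α _

/-- The support of `killOutside W f` is contained in that of `f`. [folklore] -/
theorem support_killOutside_subset (W : Finset V) (f : MvPolynomial (Fin N) ℤ) :
    (killOutside enc W f).support ⊆ f.support := by
  classical
  intro α hα
  rw [killOutside_eq_sum] at hα
  obtain ⟨β, hβ, hαβ⟩ := Finset.mem_biUnion.1 (support_sum hα)
  rw [support_monomial, if_neg (mem_support_iff.1 (Finset.mem_filter.1 hβ).1),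
    Finset.mem_singleton] at hαβ
  subst hαβ
  exact (Finset.mem_filter.1 hβ).1

/-- The exponents of `killOutside W f` are supported over `W`. [folklore] -/
theorem fst_mem_of_mem_support_killOutside (W : Finset V) (f : MvPolynomial (Fin N) ℤ)
    {α : Fin N →₀ ℕ} (hα : α ∈ (killOutside enc W f).support) {j : Fin N} (hj : j ∈ α.support) :
    (enc.symm j).1 ∈ W := by
  classical
  rw [killOutside_eq_sum] at hα
  obtain ⟨β, hβ, hαβ⟩ := Finset.mem_biUnion.1 (support_sum hα)
  rw [support_monomial, if_neg (mem_support_iff.1 (Finset.mem_filter.1 hβ).1),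
    Finset.mem_singleton] at hαβ
  subst hαβ
  exact (Finset.mem_filter.1 hβ).2 j hj

/-- A `W`-supported polynomial is fixed by `killOutside W`. [folklore] -/
theorem killOutside_eq_self {W : Finset V} {f : MvPolynomial (Fin N) ℤ}
    (hf : ∀ α ∈ f.support, ∀ j ∈ α.support, (enc.symm j).1 ∈ W) : killOutside enc W f = f := by
  classical
  rw [killOutside_eq_sum, Finset.filter_true_of_mem hf]
  exact f.as_sum.symm

/-- Evaluating `killOutside W f` at `y` is evaluating `f` at `y` with the outside coordinates
zeroed. [folklore] -/
theorem eval_killOutside (W : Finset V) (f : MvPolynomial (Fin N) ℤ) (y : Fin N → ℤ) :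
    eval y (killOutside enc W f) = eval (fun j => if (enc.symm j).1 ∈ W then y j else 0) f := by
  induction f using MvPolynomial.induction_on with
  | C c => simp [killOutside]
  | add p q hp hq => rw [map_add, map_add, hp, hq, map_add]
  | mul_X p j hp =>
    rw [map_mul, map_mul, hp, map_mul, eval_X]
    unfold killOutside
    rw [bind₁_X_right]
    split_ifs <;> simp

/-- **Claim A.2**: the normal form modulo `I(𝒱_W)` of a `W`-supported polynomial is
`W`-supported (kill the outside variables: the result is still reduced and still a representative,
by the cylinder property of `𝒱_W`, so it is the normal form). [cite: ConnerydGhannanePang2025, App. A, Claim A.2] -/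
theorem support_normalForm_subset {W : Finset V} {f : MvPolynomial (Fin N) ℤ}
    (hf : ∀ α ∈ f.support, ∀ j ∈ α.support, (enc.symm j).1 ∈ W) {α : Fin N →₀ ℕ}
    (hα : α ∈ (normalForm (pts G enc W) f).support) {j : Fin N} (hj : j ∈ α.support) :
    (enc.symm j).1 ∈ W := by
  set r := normalForm (pts G enc W) f with hr
  have hfix : normalForm (pts G enc W) f = killOutside enc W r := by
    refine normalForm_eq_of_isReduced (isZeroOne_pts W) ?_ ?_
    · exact fun β hβ => isReduced_normalForm _ f β (support_killOutside_subset W r hβ)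
    · intro y hy
      rw [map_sub, eval_killOutside, eval_normalForm _ f (restrictCode_mem_pts hy),
        ← eval_killOutside, killOutside_eq_self hf, sub_self]
  rw [← hr] at hfix
  rw [hfix] at hα
  exact fst_mem_of_mem_support_killOutside W r hα hj

end Codes

end ConnerydGhannanePang

end Literature.ModelTheory.FiniteModelTheory
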